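import Mathlib
import HarnessLib
import Literature.Analysis.FluidPDE.TypeIAncientMild
import Summits.NavierStokesRegularity.NavierStokesRegularity.Theorems.SqueezeCycleExtremalElementExistsExtraction
import Summits.NavierStokesRegularity.NavierStokesRegularity.Theorems.SymmetryModuliCountFarPastLedgerReduction
import Summits.NavierStokesRegularity.NavierStokesRegularity.Theorems.ExtremalTypeIConstantExtremalSpiralSymmetryFarPastSaturation

/-!
# Crux `ExtremalSpiralSymmetry` (stmt-NavierStokesRegularity-8215), line `registered`, towards stub 1
# (`stub_scalingRecurrence`): the blow-DOWN of an extremal pair along saturating far-past times is again extremal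

Support file (theorems only, `--supports stmt-NavierStokesRegularity-8215`; no definitions, no named facts). Lead c2.

By `extremal_farPast_saturation` an extremal pair `(C, u)` nearly attains its Type-I bound at points `(t_k, x_k)` with
`t_k → −∞`. Renormalising these points to `(−1, 0)` by the class-preserving symmetries (translation, parabolic scaling
by `λ_k = √(−t_k) → ∞`) gives a sequence in `A_C` whose values at `(−1, 0)` have norms `→ C`; the KNSS compactness of
the class (`exists_tendsto_of_isTypeIAncientMild_seq`: pointwise — slices locally uniformly — convergent subsequences
with limit in `A_C`) produces a limit `W` with `‖W(−1, 0)‖ = C`, and the minimality clause, being a property of `C`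
alone, is inherited. So:

* `extremal_blowDown_extremal` — every extremal pair `(C, u)` has BLOW-DOWN limits
  `W(t, x) = lim_j λ_j u(λ_j² t, x_j + λ_j x)` (`λ_j → ∞`, pointwise on the open slab) which are again extremal pairs
  `(C, W)`.

This is the first step of any recurrence approach to stub 1 (the α-limit set of an extremal under the scaling flow,
modulo translations, consists of extremals); what extremality does NOT give is a return of the orbit to `u` itself.
-/

noncomputable section

-- the summit and its single sub-problem share the name (CONVENTIONS §1), as in every Theorems file
set_option linter.dupNamespace false

open Set MeasureTheory Filter Topology
open Literature.Analysis.FluidPDE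

namespace Summit.NavierStokesRegularity.NavierStokesRegularity.Theorems.ExtremalSpiralSymmetry.Registered

/-- **Blow-downs of an extremal pair are extremal.** Let `(C, u)` be extremal (`u ∈ A_C` written out,
`‖u(−1,0)‖ = C > 0`, `C` minimal among the constants of nontrivial elements). Then there are scales `λ_j → ∞`, centres
`x_j` and a field `W` with `λ_j u(λ_j² t, x_j + λ_j x) → W(t, x)` for all `t < 0`, `x`, such that `(C, W)` is again an
extremal pair. (Far-past saturation `extremal_farPast_saturation` + the symmetries of the class + KNSS compactness
`exists_tendsto_of_isTypeIAncientMild_seq`.) [cite: KochNadirashviliSereginSverak2009, Prop. 4.1 and §6] -/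
theorem extremal_blowDown_extremal :
    ∀ (C : ℝ) (u : ℝ → EuclideanSpace ℝ (Fin 3) → EuclideanSpace ℝ (Fin 3)), 0 < C →
      (ContDiffOn ℝ (⊤ : ℕ∞) (Function.uncurry u) (Set.Iio 0 ×ˢ Set.univ) ∧
          (∀ t < 0, Literature.Analysis.FluidPDE.VectorCalculus.IsDivFree (u t)) ∧
          (∀ s t : ℝ, s < t → t < 0 → ∀ x, u t x =
            Literature.Analysis.FluidPDE.heatFlow (u s) (t - s) x -
              ∫ τ in Set.Ioo s t, ∫ y,
                Literature.Analysis.FluidPDE.oseenKernel (t - τ) (x - y) (u τ y) (u τ y)) ∧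
          Literature.Analysis.FluidPDE.HasTypeITimeDecay C u) ∧
        ‖u (-1) 0‖ = C ∧
        (∀ (C' : ℝ) (u' : ℝ → EuclideanSpace ℝ (Fin 3) → EuclideanSpace ℝ (Fin 3)),
          (ContDiffOn ℝ (⊤ : ℕ∞) (Function.uncurry u') (Set.Iio 0 ×ˢ Set.univ) ∧
            (∀ t < 0, Literature.Analysis.FluidPDE.VectorCalculus.IsDivFree (u' t)) ∧
            (∀ s t : ℝ, s < t → t < 0 → ∀ x, u' t x =
              Literature.Analysis.FluidPDE.heatFlow (u' s) (t - s) x -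
                ∫ τ in Set.Ioo s t, ∫ y,
                  Literature.Analysis.FluidPDE.oseenKernel (t - τ) (x - y) (u' τ y) (u' τ y)) ∧
            Literature.Analysis.FluidPDE.HasTypeITimeDecay C' u') →
          (∃ t < 0, ∃ x, u' t x ≠ 0) → C ≤ C') →
      ∃ (lam : ℕ → ℝ) (xs : ℕ → EuclideanSpace ℝ (Fin 3))
        (W : ℝ → EuclideanSpace ℝ (Fin 3) → EuclideanSpace ℝ (Fin 3)),
        (∀ j, 0 < lam j) ∧ Tendsto lam atTop atTop ∧
        (∀ t < (0 : ℝ), ∀ x, Tendsto (fun j => lam j • u (lam j ^ 2 * t) (xs j + lam j • x)) atTop (𝓝 (W t x))) ∧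
        ((ContDiffOn ℝ (⊤ : ℕ∞) (Function.uncurry W) (Set.Iio 0 ×ˢ Set.univ) ∧
            (∀ t < 0, Literature.Analysis.FluidPDE.VectorCalculus.IsDivFree (W t)) ∧
            (∀ s t : ℝ, s < t → t < 0 → ∀ x, W t x =
              Literature.Analysis.FluidPDE.heatFlow (W s) (t - s) x -
                ∫ τ in Set.Ioo s t, ∫ y,
                  Literature.Analysis.FluidPDE.oseenKernel (t - τ) (x - y) (W τ y) (W τ y)) ∧
            Literature.Analysis.FluidPDE.HasTypeITimeDecay C W) ∧
          ‖W (-1) 0‖ = C ∧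
          (∀ (C' : ℝ) (u' : ℝ → EuclideanSpace ℝ (Fin 3) → EuclideanSpace ℝ (Fin 3)),
            (ContDiffOn ℝ (⊤ : ℕ∞) (Function.uncurry u') (Set.Iio 0 ×ˢ Set.univ) ∧
              (∀ t < 0, Literature.Analysis.FluidPDE.VectorCalculus.IsDivFree (u' t)) ∧
              (∀ s t : ℝ, s < t → t < 0 → ∀ x, u' t x =
                Literature.Analysis.FluidPDE.heatFlow (u' s) (t - s) x -
                  ∫ τ in Set.Ioo s t, ∫ y,
                    Literature.Analysis.FluidPDE.oseenKernel (t - τ) (x - y) (u' τ y) (u' τ y)) ∧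
              Literature.Analysis.FluidPDE.HasTypeITimeDecay C' u') →
            (∃ t < 0, ∃ x, u' t x ≠ 0) → C ≤ C')) := by
  intro C u hC hext
  have hsat := extremal_farPast_saturation C u hC hext
  obtain ⟨hcls, hnorm, hmin⟩ := hext
  have hA : IsTypeIAncientMild C u := isTypeIAncientMild_iff.2 hcls
  -- saturating far-past points `(t_k, x_k)`, `t_k < -(k+1)²`
  have hpts : ∀ k : ℕ, ∃ t < -(((k : ℝ) + 1) ^ 2), ∃ x : EuclideanSpace ℝ (Fin 3),
      (C - 1 / ((k : ℝ) + 1)) / Real.sqrt (-t) < ‖u t x‖ := fun k =>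
    hsat (1 / ((k : ℝ) + 1)) (by positivity) (-(((k : ℝ) + 1) ^ 2)) (neg_neg_of_pos (by positivity))
  choose tk htk xk hxk using hpts
  have htk0 : ∀ k, tk k < 0 := fun k => (htk k).trans (neg_neg_of_pos (by positivity))
  -- scales and renormalised fields
  set lam : ℕ → ℝ := fun k => Real.sqrt (-tk k) with hlam
  have hlam_pos : ∀ k, 0 < lam k := fun k => Real.sqrt_pos.2 (neg_pos.2 (htk0 k))
  have hlam_gt : ∀ k : ℕ, (k : ℝ) + 1 < lam k := fun k => by
    have h1 : ((k : ℝ) + 1) ^ 2 < -tk k := by linarith [htk k]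
    calc (k : ℝ) + 1 = Real.sqrt (((k : ℝ) + 1) ^ 2) := (Real.sqrt_sq (by positivity)).symm
      _ < Real.sqrt (-tk k) := Real.sqrt_lt_sqrt (by positivity) h1
  have hlam_top : Tendsto lam atTop atTop := by
    refine tendsto_atTop_mono (fun k => (hlam_gt k).le) ?_
    exact tendsto_atTop_add_const_right _ 1 tendsto_natCast_atTop_atTop
  set v : ℕ → ℝ → EuclideanSpace ℝ (Fin 3) → EuclideanSpace ℝ (Fin 3) := fun k =>
    nsRescale (lam k) (fun t x => u t (xk k + x)) with hv
  have hvA : ∀ k, IsTypeIAncientMild C (v k) := fun k =>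
    Summit.NavierStokesRegularity.NavierStokesRegularity.Theorems.isTypeIAncientMild_nsRescale
      (Summit.NavierStokesRegularity.NavierStokesRegularity.Theorems.isTypeIAncientMild_translate hA (xk k))
      (hlam_pos k)
  have hv_apply : ∀ k t x, v k t x = lam k • u (lam k ^ 2 * t) (xk k + lam k • x) := fun k t x => by
    simp [hv, nsRescale_apply]
  -- the value at the hot spot: `‖v_k(-1, 0)‖ = √(-t_k) ‖u(t_k, x_k)‖ > C - 1/(k+1)`
  have hv_hot : ∀ k : ℕ, C - 1 / ((k : ℝ) + 1) < ‖v k (-1) 0‖ := by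
    intro k
    have e1 : lam k ^ 2 * (-1 : ℝ) = tk k := by
      rw [hlam]; simp only
      rw [Real.sq_sqrt (neg_pos.2 (htk0 k)).le]; ring
    rw [hv_apply, e1, smul_zero, add_zero, norm_smul, Real.norm_of_nonneg (hlam_pos k).le]
    have h := hxk k
    rw [div_lt_iff₀ (hlam_pos k)] at h
    linarith [h]
  -- KNSS compactness
  obtain ⟨φ, hφ, W, hW, hpt, -, -, -⟩ :=
    Summit.NavierStokesRegularity.NavierStokesRegularity.Theorems.exists_tendsto_of_isTypeIAncientMild_seq C hvA
  refine ⟨fun j => lam (φ j), fun j => xk (φ j), W, fun j => hlam_pos _, hlam_top.comp hφ.tendsto_atTop,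
    fun t ht x => ?_, isTypeIAncientMild_iff.1 hW, ?_, hmin⟩
  · simpa only [hv_apply] using hpt t ht x
  · -- `‖W(-1,0)‖ = C`: `≤` from the class, `≥` from the hot values in the limit
    have hup : ‖W (-1) 0‖ ≤ C := by
      have h := hW.norm_le (show (-1 : ℝ) < 0 by norm_num) 0
      rwa [neg_neg, Real.sqrt_one, div_one] at h
    have hlim : Tendsto (fun j => ‖v (φ j) (-1) 0‖) atTop (𝓝 ‖W (-1) 0‖) :=
      (hpt (-1) (by norm_num) 0).norm
    have hlow : C ≤ ‖W (-1) 0‖ := by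
      have hCj : Tendsto (fun j : ℕ => C - 1 / (((φ j : ℕ) : ℝ) + 1)) atTop (𝓝 (C - 0)) := by
        refine tendsto_const_nhds.sub ?_
        have h1 : Tendsto (fun j : ℕ => ((φ j : ℕ) : ℝ) + 1) atTop atTop :=
          tendsto_atTop_add_const_right _ 1
            (tendsto_natCast_atTop_atTop.comp hφ.tendsto_atTop)
        have h2 := tendsto_inv_atTop_zero.comp h1
        simpa [Function.comp_def, one_div] using h2
      rw [sub_zero] at hCj
      exact le_of_tendsto_of_tendsto' hCj hlim fun j => (hv_hot (φ j)).le
    exact le_antisymm hup hlow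

end Summit.NavierStokesRegularity.NavierStokesRegularity.Theorems.ExtremalSpiralSymmetry.Registered

end
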